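import Summits.AtomisticToContinuum.Crystallization.Theorems.DisclinationRationUniformPolytypeStabilityDefs

/-!
# `UniformPolytypeStability` (stmt-AtomisticToContinuum-15800), line `birth` (v2, cells): helpers for `stub_nearCells`

Route `DisclinationRation`, crux `UniformPolytypeStability`, line `birth` (lead
prover-line-stmt-AtomisticToContinuum-15800-0).  This is the FIRST of two `--supports` files of the stub
`stub_nearCells : … → SitesFacts a s z → NearCellFacts a s z` (near pair sums over `Idx × Idx` regroup into sums
over the parallelepiped cells of the line vocabulary `…Theorems.DisclinationRationUniformPolytypeStabilityDefs`).
It carries the registered anchor `stub_nearCellsAux1` (injectivity of the corner map `ι ↦ cvert s ι 000`, an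
instance of `StubNearCells.cvert_injective`) and the GENERIC bookkeeping, valid for any pair functional
`T : Idx → Idx → ℝ` that is symmetric and vanishes when both arguments are outside a finite set `S`:

* TWISTED SHIFTS of the index lattice `Idx = ℤ³`: `x ↦ (x.1 + dz, x.2.1 + s (x.1 − e)·dx, x.2.2 + s (x.1 − e)·dy)`
  (shift by `dz` layers and by the in-plane offset `(dx, dy)` twisted by the letter of the slab `x.1 − e`); they are
  injective (`shift_injective`, a shear), every corner map `ι ↦ cvert s ι c` is one, and the second corner of a
  bond is the twisted shift of the first by the cube offset `c' − c`, twist read at the slab `x.1 − c.z`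
  (`cvert_corner_shift`);
* CLASS SUMS `∑' x, T x (shift x)`: summable (`summable_along`), invariant under reversal of the class
  (`tsum_shift_swap : (e, d) ↦ (e + d.1, −d)`, by reindexing along the shift and symmetry of `T`), and blind to the
  twist for in-plane classes when `s = ±1` (`tsum_shift_untwist`, a layerwise reindexing);
* CELL SIDE: `∑' ι, T (cvert ι c) (cvert ι c')` is the class sum of the bond's offset (`tsum_corner`), so the sum
  over cells of a weighted bond sum `Σ_{b ∈ bondTable} w b · T (corner b.1) (corner b.2)` is the weighted list sum of
  class sums (`tsum_cellSum`), and these cell functionals are finitely supported (`finite_support_cellSum`);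
* PAIR SIDE (`tsum_pairs`): if `P x y` says exactly "`y` is one of finitely many pairwise distinct shifts `φ b x`,
  `b ∈ L`", then `(x, y) ↦ [P x y] · T x y` is summable on `Idx × Idx` with sum `Σ_{b ∈ L} ∑' x, T x (φ b x)`
  (graph by graph, `Function.Injective.tsum_eq`).

The second file (`…NearCells.lean`) supplies the lists of 18 near / 12 nearest-neighbour shifts, checks them
against `NearPair` / `NNPair`, and does the share bookkeeping of `bondTable`.  All sums are finitely supported;
`tsum`s of list sums are `tsum_list_sum`.  Everything is `[folklore]`; no definitions; nothing here closes an item.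
-/

noncomputable section

namespace Summit.AtomisticToContinuum.Crystallization.Theorems.UniformPolytypeStabilityCells

open scoped BigOperators Topology Classical InnerProductSpace
open Filter Set Function
open Literature.MathematicalPhysics.StatisticalMechanics
open Summit.AtomisticToContinuum.Crystallization.Theorems.PhononStabilityNegative

namespace StubNearCells

/-! ## List sums under `tsum` -/

/-- A list sum of summable real families is summable. [folklore] -/
theorem summable_list_sum {β γ : Type*} (L : List β) (f : β → γ → ℝ) (h : ∀ b ∈ L, Summable (f b)) :
    Summable fun c => (L.map fun b => f b c).sum := by
  induction L with
  | nil => simp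
  | cons b L ih =>
    simp only [List.map_cons, List.sum_cons]
    exact (h b (by simp)).add (ih fun b' hb' => h b' (by simp [hb']))

/-- `∑'` of a list sum of summable real families is the list sum of the `∑'`s. [folklore] -/
theorem tsum_list_sum {β γ : Type*} (L : List β) (f : β → γ → ℝ) (h : ∀ b ∈ L, Summable (f b)) :
    ∑' c, (L.map fun b => f b c).sum = (L.map fun b => ∑' c, f b c).sum := by
  induction L with
  | nil => simp
  | cons b L ih =>
    simp only [List.map_cons, List.sum_cons]
    rw [(h b (by simp)).tsum_add (summable_list_sum L f fun b' hb' => h b' (by simp [hb'])),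
      ih fun b' hb' => h b' (by simp [hb'])]

/-! ## Sums of a pair functional along maps of the index lattice -/

variable (T : Idx → Idx → ℝ)

/-- If `T` vanishes when both arguments are outside a finite set, then `x ↦ T x (φ x)` is finitely supported, hence
summable, for every injective `φ`. [folklore] -/
theorem summable_along {S : Set Idx} (hS : S.Finite) (hT0 : ∀ x y, x ∉ S → y ∉ S → T x y = 0)
    {φ : Idx → Idx} (hφ : Injective φ) : Summable fun x => T x (φ x) := by
  refine summable_of_hasFiniteSupport ((hS.union (hS.preimage hφ.injOn)).subset fun x hx => ?_)
  by_contra h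
  simp only [Set.mem_union, Set.mem_preimage, not_or] at h
  exact hx (hT0 _ _ h.1 h.2)

/-- **Reversal.** For symmetric `T` and mutually inverse `φ`, `ψ`: `∑' x, T x (φ x) = ∑' x, T x (ψ x)`
(reindex `x ↦ φ x`). [folklore] -/
theorem tsum_along_symm (hT : ∀ x y, T x y = T y x) (φ ψ : Idx → Idx) (h1 : ∀ x, ψ (φ x) = x)
    (h2 : ∀ x, φ (ψ x) = x) : ∑' x, T x (φ x) = ∑' x, T x (ψ x) := by
  let e : Idx ≃ Idx := ⟨φ, ψ, h1, h2⟩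
  symm
  rw [← e.tsum_eq]
  refine tsum_congr fun x => ?_
  show T (φ x) (ψ (φ x)) = T x (φ x)
  rw [h1, hT]

/-- The twisted shift `x ↦ (x.1 + dz, x.2.1 + τ x.1 · dx, x.2.2 + τ x.1 · dy)` is injective (it is the shear
`Equiv.prodShear` over the layer coordinate). [folklore] -/
theorem shift_injective (τ : ℤ → ℤ) (dz dx dy : ℤ) :
    Injective fun x : Idx => (x.1 + dz, x.2.1 + τ x.1 * dx, x.2.2 + τ x.1 * dy) :=
  (Equiv.prodShear (Equiv.addRight dz) fun m => Equiv.addRight (τ m * dx, τ m * dy)).injective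

/-- **Reversal of a twisted offset class.** For symmetric `T`, the class sum of the twisted offset `(dz, dx, dy)`
read at slab shift `e` equals the class sum of the reversed offset read at slab shift `e + dz` (the primed data are
the reversed class; stated with equations so that instances are syntactic). [folklore] -/
theorem tsum_shift_swap (hT : ∀ x y, T x y = T y x) (s : ℤ → ℤ) (e dz dx dy e' dz' dx' dy' : ℤ)
    (he : e' = e + dz) (hdz : dz' = -dz) (hdx : dx' = -dx) (hdy : dy' = -dy) :
    ∑' x : Idx, T x (x.1 + dz, x.2.1 + s (x.1 - e) * dx, x.2.2 + s (x.1 - e) * dy) =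
      ∑' x : Idx, T x (x.1 + dz', x.2.1 + s (x.1 - e') * dx', x.2.2 + s (x.1 - e') * dy') := by
  subst he hdz hdx hdy
  refine tsum_along_symm T hT _ _ (fun x => ?_) (fun x => ?_)
  · obtain ⟨m, i, j⟩ := x
    simp only [Prod.mk.injEq]
    rw [show m + dz - (e + dz) = m - e by ring]
    exact ⟨by ring, by ring, by ring⟩
  · obtain ⟨m, i, j⟩ := x
    simp only [Prod.mk.injEq]
    rw [show m + -dz - e = m - (e + dz) by ring]
    exact ⟨by ring, by ring, by ring⟩

/-- **Untwisting of an in-plane class.** For symmetric `T` and letters `s = ±1`, an in-plane class sum does not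
see the twist (on the layers with letter `−1` reindex by `x ↦ x − (0, q, r)` and use symmetry). [folklore] -/
theorem tsum_shift_untwist (hT : ∀ x y, T x y = T y x) {s : ℤ → ℤ} (hs : IsHaggSeq s) (e q r : ℤ) :
    ∑' x : Idx, T x (x.1 + 0, x.2.1 + s (x.1 - e) * q, x.2.2 + s (x.1 - e) * r) =
      ∑' x : Idx, T x (x.1, x.2.1 + q, x.2.2 + r) := by
  set c : ℤ → ℤ × ℤ := fun m => if s (m - e) = 1 then (0, 0) else (-q, -r)
  set ρ : Idx ≃ Idx := Equiv.prodShear (Equiv.refl ℤ) fun m => Equiv.addRight (c m)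
  have hρx : ∀ x : Idx, ρ x = (x.1, x.2.1 + (c x.1).1, x.2.2 + (c x.1).2) := fun x => rfl
  symm
  rw [← ρ.tsum_eq]
  refine tsum_congr fun x => ?_
  obtain ⟨m, i, j⟩ := x
  rw [hρx]
  rcases hs (m - e) with h | h
  · have hcm : c m = (0, 0) := if_pos h
    simp only [hcm, add_zero, h, one_mul]
  · have hcm : c m = (-q, -r) := if_neg (by rw [h]; decide)
    simp only [hcm, h, neg_one_mul, add_zero, ← sub_eq_add_neg, sub_add_cancel]
    exact hT _ _

/-! ## Cell side -/

/-- Each corner map `ι ↦ cvert s ι c` is injective (it is a twisted shift). [folklore] -/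
theorem cvert_injective (s : ℤ → ℤ) (c : Corner) : Injective fun ι : CIdx => cvert s ι c :=
  (Equiv.prodShear (Equiv.addRight ((c.2.2 : ℕ) : ℤ)) fun m =>
    Equiv.addRight (s m * ((c.1 : ℕ) : ℤ), s m * ((c.2.1 : ℕ) : ℤ))).injective

/-- The corner `c'` of a cell is the twisted shift of its corner `c` by the cube offset `c' − c`, the twist being
read at the slab `(cvert ι c).1 − c.z`. [folklore] -/
theorem cvert_corner_shift (s : ℤ → ℤ) (ι : CIdx) (c c' : Corner) :
    cvert s ι c' = ((cvert s ι c).1 + (((c'.2.2 : ℕ) : ℤ) - ((c.2.2 : ℕ) : ℤ)),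
      (cvert s ι c).2.1 + s ((cvert s ι c).1 - ((c.2.2 : ℕ) : ℤ)) * (((c'.1 : ℕ) : ℤ) - ((c.1 : ℕ) : ℤ)),
      (cvert s ι c).2.2 + s ((cvert s ι c).1 - ((c.2.2 : ℕ) : ℤ)) * (((c'.2.1 : ℕ) : ℤ) - ((c.2.1 : ℕ) : ℤ))) := by
  obtain ⟨k, n₁, n₂⟩ := ι
  simp only [cvert, Prod.mk.injEq, add_sub_cancel_right]
  exact ⟨by ring, by ring, by ring⟩

/-- The sum over cells of `T` on the bond `(c, c')` is the class sum of the bond's twisted offset (reindex along the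
corner map `ι ↦ cvert s ι c`). [folklore] -/
theorem tsum_corner (s : ℤ → ℤ) (c c' : Corner) :
    ∑' ι, T (cvert s ι c) (cvert s ι c') =
      ∑' x : Idx, T x (x.1 + (((c'.2.2 : ℕ) : ℤ) - ((c.2.2 : ℕ) : ℤ)),
        x.2.1 + s (x.1 - ((c.2.2 : ℕ) : ℤ)) * (((c'.1 : ℕ) : ℤ) - ((c.1 : ℕ) : ℤ)),
        x.2.2 + s (x.1 - ((c.2.2 : ℕ) : ℤ)) * (((c'.2.1 : ℕ) : ℤ) - ((c.2.1 : ℕ) : ℤ))) := by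
  symm
  rw [← (Equiv.prodShear (Equiv.addRight ((c.2.2 : ℕ) : ℤ)) fun m =>
    Equiv.addRight (s m * ((c.1 : ℕ) : ℤ), s m * ((c.2.1 : ℕ) : ℤ))).tsum_eq]
  refine tsum_congr fun ι => ?_
  rw [cvert_corner_shift s ι c c']
  rfl

/-- `ι ↦ T (cvert ι c) (cvert ι c')` is summable (finitely supported) when `T` vanishes off a finite set. [folklore] -/
theorem summable_corner {S : Set Idx} (hS : S.Finite) (hT0 : ∀ x y, x ∉ S → y ∉ S → T x y = 0)
    (s : ℤ → ℤ) (c c' : Corner) : Summable fun ι => T (cvert s ι c) (cvert s ι c') := by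
  refine summable_of_hasFiniteSupport
    (((hS.preimage (cvert_injective s c).injOn).union (hS.preimage (cvert_injective s c').injOn)).subset
      fun ι hι => ?_)
  by_contra h
  simp only [Set.mem_union, Set.mem_preimage, not_or] at h
  exact hι (hT0 _ _ h.1 h.2)

/-- The sum over cells of a weighted bond sum `Σ_{b ∈ bondTable} w b · T (corner b.1) (corner b.2)` is the weighted
list sum of the class sums of the 21 bonds. [folklore] -/
theorem tsum_cellSum (w : Corner × Corner × ℚ × Bool → ℝ) {S : Set Idx} (hS : S.Finite)
    (hT0 : ∀ x y, x ∉ S → y ∉ S → T x y = 0) (s : ℤ → ℤ) :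
    ∑' ι, (bondTable.map fun b => w b * T (cvert s ι b.1) (cvert s ι b.2.1)).sum =
      (bondTable.map fun b => w b *
        ∑' x : Idx, T x (x.1 + (((b.2.1.2.2 : ℕ) : ℤ) - ((b.1.2.2 : ℕ) : ℤ)),
          x.2.1 + s (x.1 - ((b.1.2.2 : ℕ) : ℤ)) * (((b.2.1.1 : ℕ) : ℤ) - ((b.1.1 : ℕ) : ℤ)),
          x.2.2 + s (x.1 - ((b.1.2.2 : ℕ) : ℤ)) * (((b.2.1.2.1 : ℕ) : ℤ) - ((b.1.2.1 : ℕ) : ℤ)))).sum := by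
  rw [tsum_list_sum bondTable (fun b ι => w b * T (cvert s ι b.1) (cvert s ι b.2.1))
    fun b _ => (summable_corner T hS hT0 s b.1 b.2.1).mul_left (w b)]
  simp only [tsum_mul_left, tsum_corner T]

/-- The weighted bond sums are finitely supported in the cell index: a cell all of whose corners are outside the
finite set `S` contributes `0`. [folklore] -/
theorem finite_support_cellSum (w : Corner × Corner × ℚ × Bool → ℝ) {S : Set Idx} (hS : S.Finite)
    (hT0 : ∀ x y, x ∉ S → y ∉ S → T x y = 0) (s : ℤ → ℤ) :
    (Function.support fun ι => (bondTable.map fun b => w b * T (cvert s ι b.1) (cvert s ι b.2.1)).sum).Finite := by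
  refine (Set.finite_iUnion fun c : Corner => hS.preimage (cvert_injective s c).injOn).subset
    fun ι hι => ?_
  by_contra h
  simp only [Set.mem_iUnion, Set.mem_preimage, not_exists] at h
  refine hι (List.sum_eq_zero fun t ht => ?_)
  obtain ⟨b, -, rfl⟩ := List.mem_map.1 ht
  rw [hT0 _ _ (h _) (h _), mul_zero]

/-! ## Pair side -/

/-- **Pair sums, graph by graph.**  Let `P x y` hold exactly when `y` is one of the shifts `φ b x`, `b ∈ L`, these
being pairwise distinct for each `x`, each `φ b` injective.  Then `(x, y) ↦ [P x y] · T x y` is summable on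
`Idx × Idx` and its sum is `Σ_{b ∈ L} ∑' x, T x (φ b x)` (each graph `{(x, φ b x)}` is summed by
`Function.Injective.tsum_eq`). [folklore] -/
theorem tsum_pairs {S : Set Idx} (hS : S.Finite) (hT0 : ∀ x y, x ∉ S → y ∉ S → T x y = 0)
    {β : Type*} {L : List β} {φ : β → Idx → Idx} (P : Idx → Idx → Prop)
    (hiff : ∀ x y, P x y ↔ y ∈ L.map (fun b => φ b x)) (hnodup : ∀ x, (L.map fun b => φ b x).Nodup)
    (hφ : ∀ b, Injective (φ b)) :
    Summable (fun p : Idx × Idx => if P p.1 p.2 then T p.1 p.2 else 0) ∧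
      ∑' p : Idx × Idx, (if P p.1 p.2 then T p.1 p.2 else 0) = (L.map fun b => ∑' x, T x (φ b x)).sum := by
  set g : β → Idx × Idx → ℝ := fun b p => if p.2 = φ b p.1 then T p.1 p.2 else 0 with hg
  have hptw : ∀ p : Idx × Idx, (if P p.1 p.2 then T p.1 p.2 else 0) = (L.map fun b => g b p).sum := by
    intro p
    have hmap : (L.map fun b => g b p) =
        (L.map fun b => φ b p.1).map fun y => if p.2 = y then T p.1 p.2 else 0 := by
      rw [List.map_map]; rfl
    rw [hmap, ← List.sum_toFinset _ (hnodup p.1), Finset.sum_ite_eq]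
    by_cases hP : P p.1 p.2
    · rw [if_pos hP, if_pos (List.mem_toFinset.2 ((hiff _ _).1 hP))]
    · rw [if_neg hP, if_neg fun h => hP ((hiff _ _).2 (List.mem_toFinset.1 h))]
  have hinj : ∀ b, Injective fun x : Idx => (x, φ b x) := fun b x y h => congrArg Prod.fst h
  have hsupp : ∀ b, support (g b) ⊆ Set.range (fun x : Idx => (x, φ b x)) := by
    intro b p hp
    by_cases h : p.2 = φ b p.1
    · exact ⟨p.1, Prod.ext rfl h.symm⟩
    · exact absurd (if_neg h) hp
  have hcomp : ∀ b, (g b ∘ fun x : Idx => (x, φ b x)) = fun x => T x (φ b x) := by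
    intro b; funext x; simp [hg]
  have hgsum : ∀ b, Summable (g b) := fun b =>
    ((hinj b).summable_iff fun p hp => notMem_support.1 fun h => hp (hsupp b h)).1
      (by rw [hcomp]; exact summable_along T hS hT0 (hφ b))
  have hgtsum : ∀ b, ∑' p, g b p = ∑' x, T x (φ b x) := fun b => by
    rw [← (hinj b).tsum_eq (hsupp b)]
    simp [hg]
  have hfun : (fun p : Idx × Idx => if P p.1 p.2 then T p.1 p.2 else 0) =
      fun p => (L.map fun b => g b p).sum := funext hptw
  rw [hfun]
  refine ⟨summable_list_sum L g fun b _ => hgsum b, ?_⟩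
  rw [tsum_list_sum L g fun b _ => hgsum b]
  simp only [hgtsum]

end StubNearCells

/-- Registered anchor `stub_nearCellsAux1` of this helper file: the corner map `ι ↦ cvert s ι 000` of the cells is
injective (instance of `StubNearCells.cvert_injective`). [folklore] -/
theorem stub_nearCellsAux1 : ∀ s : ℤ → ℤ, Function.Injective fun ι : CIdx => cvert s ι (mkC 0 0 0) :=
  fun s => StubNearCells.cvert_injective s _

end Summit.AtomisticToContinuum.Crystallization.Theorems.UniformPolytypeStabilityCells

end
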